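import Summits.QuantumFields.YangMills.Theorems.FlatTubeReductionDecimationSupport
import Summits.QuantumFields.YangMills.Theorems.FemtoCutoffLadderThinningAveraged
import Literature.Probability.Independence.HoeffdingDecompositionPartsTransport
import HarnessLib

/-!
# Route `FlatTubeReduction`, crux `PinnedUnitStepEx` (stmt-QuantumFields-27561), stub `stub_smearVarPosGS1` — R1: Hoeffding parts of a
# translation-invariant observable on translated link sets

Seat ym-line-fcl-p3 g9 (2026-08-28).  Blueprint (extremal part, memo §P5): the support `supp g = {R : g^{=R} ≠ 0 a.e.}` of the Hoeffding
decomposition of a TRANSLATION-INVARIANT coarse observable `g` is translation invariant, because the part on a translated link set is the part on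
the original set read through the translated configuration:
* `esPart_image_shift` — `g^{=R+w}(U) = g^{=R}(τ_{−w} U)` (`R + w = {(x+w,i) : (x,i) ∈ R}`; from `Hoeffding.esPart_comp_image` with the edge
  permutation and `g ∘ τ = g`);
* `esPart_image_shift_ae_eq_zero_iff` — hence `g^{=R+w} = 0` a.e. iff `g^{=R} = 0` a.e. (translations preserve `configMeasure`).
R2b1 RECORD rung; no summit/crux/stub here.
-/

set_option autoImplicit false

noncomputable section

namespace Summit.QuantumFields.YangMills.Theorems.FlatTubeReduction.Decimation

open MeasureTheory Finset Function
open Literature.MathematicalPhysics.QuantumFieldTheory (Site Edge GaugeConfig haarProbability)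
open Literature.MathematicalPhysics.QuantumFieldTheory.TorusTranslation
open Summit.QuantumFields.YangMills.Theorems.FemtoTransferGap (configMeasure)
open Literature.Probability.Independence.Hoeffding

variable {G : Type*} [Group G] [MeasurableSpace G] {M : ℕ} [NeZero M]

omit [Group G] [MeasurableSpace G] [NeZero M] in
/-- The edge translation `(x, i) ↦ (x + w, i)` is injective. [folklore] -/
theorem edgeShift_injective (w : Site 3 M) : Injective fun e : Edge 3 M => (e.1 + w, e.2) := by
  intro e e' h
  simp only [Prod.mk.injEq, add_left_inj] at h
  exact Prod.ext h.1 h.2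

omit [Group G] [NeZero M] in
/-- Reading a configuration through the edge translation is the torus shift `τ_{−w}`. [folklore] -/
theorem comp_edgeShift_eq (w : Site 3 M) (U : GaugeConfig 3 M G) :
    (U ∘ fun e : Edge 3 M => (e.1 + w, e.2)) = torusConfigShift (-w) U := by
  funext e
  simp [torusConfigShift_apply, sub_neg_eq_add]

variable [TopologicalSpace G] [IsTopologicalGroup G] [CompactSpace G] [BorelSpace G]

/-- ★ **Parts on translated link sets**: for a translation-invariant bounded measurable `g`, `g^{=R+w}(U) = g^{=R}(τ_{−w} U)`. [folklore] -/
theorem esPart_image_shift {g : GaugeConfig 3 M G → ℝ} (hg : Measurable g) {C : ℝ} (hC : ∀ U, |g U| ≤ C)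
    (hTI : ∀ (v : Site 3 M) (U : GaugeConfig 3 M G), g (torusConfigShift v U) = g U) (R : Finset (Edge 3 M)) (w : Site 3 M) :
    esPart (haarProbability G) (R.image fun e : Edge 3 M => (e.1 + w, e.2)) g =
      fun U => esPart (haarProbability G) R g (torusConfigShift (-w) U) := by
  funext U
  have hginv : (fun z' : GaugeConfig 3 M G => g (z' ∘ fun e : Edge 3 M => (e.1 + w, e.2))) = g := by
    funext z'; rw [comp_edgeShift_eq, hTI]
  have h := esPart_comp_image (μ := haarProbability G) (f := g) (edgeShift_injective w) hg hC R U
  rw [hginv, comp_edgeShift_eq] at h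
  exact h

/-- ★ **The support of the decomposition is translation invariant**: `g^{=R+w} = 0` a.e. iff `g^{=R} = 0` a.e. [folklore] -/
theorem esPart_image_shift_ae_eq_zero_iff {g : GaugeConfig 3 M G → ℝ} (hg : Measurable g) {C : ℝ} (hC : ∀ U, |g U| ≤ C)
    (hTI : ∀ (v : Site 3 M) (U : GaugeConfig 3 M G), g (torusConfigShift v U) = g U) (R : Finset (Edge 3 M)) (w : Site 3 M) :
    esPart (haarProbability G) (R.image fun e : Edge 3 M => (e.1 + w, e.2)) g =ᵐ[configMeasure G M] 0 ↔
      esPart (haarProbability G) R g =ᵐ[configMeasure G M] 0 := by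
  rw [esPart_image_shift hg hC hTI R w]
  have hmp := Summit.QuantumFields.YangMills.Theorems.FemtoTransferGap.measurePreserving_torusConfigShift_configMeasure G (L := M) (-w)
  have hmp' := Summit.QuantumFields.YangMills.Theorems.FemtoTransferGap.measurePreserving_torusConfigShift_configMeasure G (L := M) w
  constructor
  · intro h
    -- compose with the inverse translation `τ_w`
    have h2 := hmp'.quasiMeasurePreserving.ae_eq_comp h
    have hid : ∀ U : GaugeConfig 3 M G, torusConfigShift (-w) (torusConfigShift w U) = U := fun U => by
      rw [Summit.QuantumFields.YangMills.Theorems.FemtoTransferGap.torusConfigShift_torusConfigShift, neg_add_cancel,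
        Summit.QuantumFields.YangMills.Theorems.FemtoTransferGap.torusConfigShift_zero]
    simp only [Function.comp_def, hid] at h2
    exact h2
  · intro h
    exact hmp.quasiMeasurePreserving.ae_eq_comp h

end Summit.QuantumFields.YangMills.Theorems.FlatTubeReduction.Decimation
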